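import Literature.NumberTheory.LFunctions.ZetaSpacingDensityRH
import HarnessLib

/-!
# Route `PrimeLevelFamEdge` — TYPED IDEA DELTAS, deck 18b: `barrier` lens × CI-GAPS — K-L21-3 «COMMENSURATE-LATTICE DUAL
# WITNESSES: AH¼, THE (1/2m)ℤ FAMILY, AND THE REALISABILITY DOOR» (cell ls-idea, seat ls-idea-lens-21 g2, cards K-L21-3 /
# N-L21-2 / M-L21-4; the seat's `Sketch_L21_DualWitness.lean` v1.2 sha16 283bb44fc6a61ef6, critic F b26 PASS + b26.1 «v1.2
# VERIFIED; if porting, port v1.2»; LANDING NOTE typer ls-idea-typ-1 gen 3: VERBATIM up to the namespace `LsIdea.Lens21.Dual` →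
# `…Theorems.PrimeLevelFamEdgeIdeaDeltas.FloorDual` and this header.  NB `FloorDual.IsFloorAdmissible` = deck 18's
# `FloorInput.IsFloorAdmissible` PLUS the two quadratic-decay fields of v1.2 (F P-F26-9: the wall is kernel-reachable for
# the quadratic-decay SUBCLASS of BGMM's class — all certificates of record); `FloorDual.cValueHeight` = deck 18's
# `cValueFloor` with an interval integral.)

The DUAL of the cell's one-sided floor LPs at PAIR level: `IsDualWitness ρ₂ ν c B` (hard core ½, form factor = Montgomery
on `[−1,1]`, free positive `ν ≥ c` on `1 < |α| < B`, Parseval pairing), tameness `IsTameWitness` (v1.2, closes the junk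
`ν = ∞` loophole); PROVED `weakDuality_floor` (a witness at height `c` kills EVERY one-sided certificate of any degree /
band-limit, window `< ½`), `IsDualWitness.mono`, the AH¼ closed form (`quarterLevel = (π²−4π+8)/(2π(π−2)) = 0.7393…`,
`quarterCoeff_one : c₁ = 0`, `quarterWitnessNonneg : c_k ≥ 0 (k ≥ 2)`, brackets `7/10 ≤ t ≤ 1`), and
`heightWallLowerEdge_of : QuarterWitnessExists → HeightWallLowerEdge` (no floor certificate at any height `≤ 0.7393`, any
`B ≤ 3`); TYPED ONLY (hypothesis / conjecture shapes, never asserted): `QuarterWitnessExists` (Poisson summation on `¼ℤ`),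
`LaplaceNoTieAtAH`, `LaplaceDoorClosedBeyondTwo` (witness-grade numerics of record, HOME/ls-idea-lens-21/L21-WITNESS-OUTPUTS.md),
`KLSRealisable` (Kuna–Lebowitz–Speer 2011 Thm 3.2 shape), `RealisableWitness`, `RealisabilityDoor`, `QuarterWitnessRealisable`.

HONESTY: no exceptional-zero theorem (no Landau–Siegel / Siegel-zero exclusion, no Theorem 1–2 of arXiv:2211.02515, no
repaired Margin232) is proved here; nothing proves the CI door, `X`, RH-conditional gap statements or any realisability
claim; typed ≠ proved; computed ≠ proved.
-/

namespace Summit.Parity.GeneralizedHardyLittlewood.Theorems.PrimeLevelFamEdgeIdeaDeltas.FloorDual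

open Literature.NumberTheory.LFunctions MeasureTheory
open scoped Real

/-! ### The one-sided minorant class and the floor certificate (as in the lineage sketch K-L21-1) -/

/-- BGMM's `𝒜(λ)` with `r̂ ≥ 0` demanded only for `|α| ≥ 1` (K-L21-1's door class), with the standard
quadratic decay of `r` and `r̂` made explicit (v1.2; satisfied by every certificate of record: Selberg /
Beurling / cosine-basis minorants have `r = O(u⁻²)` and compactly supported or `O(α⁻²)` transforms) — the
decay is what makes pairing against lattice / periodic witness measures absolutely convergent. -/
structure IsFloorAdmissible (r : ℝ → ℝ) (lam : ℝ) : Prop where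
  even : ∀ u : ℝ, r (-u) = r u
  continuous : Continuous r
  integrable : MeasureTheory.Integrable r
  map_zero : r 0 = 1
  nonpos : ∀ u : ℝ, lam < |u| → r u ≤ 0
  transform_nonneg_tail : ∀ α : ℝ, 1 ≤ |α| → 0 ≤ BGMM2023.cosTransform r α
  decay : ∃ C : ℝ, ∀ u : ℝ, |r u| ≤ C / (1 + u ^ 2)
  transform_decay : ∃ C : ℝ, ∀ α : ℝ, |BGMM2023.cosTransform r α| ≤ C / (1 + α ^ 2)

/-- Criterion value with constant-floor credit on `1 < |α| < B`: `c(λ;r) + 2c∫₁ᴮ r̂`. -/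
noncomputable def cValueHeight (r : ℝ → ℝ) (c B : ℝ) : ℝ :=
  BGMM2023.cValue r + 2 * c * ∫ α in (1 : ℝ)..B, BGMM2023.cosTransform r α

/-- "The one-sided class certifies window `lam` from the height-`c` floor on `(1,B)`." -/
def HeightCertificate (c B lam : ℝ) : Prop :=
  1 ≤ B ∧ ∃ r : ℝ → ℝ, IsFloorAdmissible r lam ∧ 0 < cValueHeight r c B

/-! ### Dual witnesses (pair level) -/

/-- A PAIR-LEVEL DUAL WITNESS for the height-`c` floor on `1 < |α| < B`: a positive even measure `ρ₂`
(pair correlation of a would-be zero process, intensity 1) with NO MASS on `|u| < ½` (no sub-half gaps),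
a positive measure `ν` on `|α| > 1` (the form factor beyond the diagonal) dominating `c·Lebesgue` on
`1 < |α| < B`, and the PARSEVAL/EXPLICIT-FORMULA identity against every test function of the class with
Montgomery's `|α| + δ₀` on `[−1,1]`.  (For the lattice witnesses the identity is Poisson summation.) -/
structure IsDualWitness (ρ₂ ν : Measure ℝ) (c B : ℝ) : Prop where
  core : ρ₂ (Set.Ioo (-(1 / 2 : ℝ)) (1 / 2)) = 0
  offDiag : ν (Set.Icc (-1 : ℝ) 1) = 0
  floor : (ENNReal.ofReal c) • (volume.restrict (Set.Ioo (1 : ℝ) B ∪ Set.Ioo (-B) (-1))) ≤ ν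
  /-- Montgomery pairing on `[−1,1]` written in BGMM's even normal form `r̂(0) + 2∫₀¹ α r̂(α) dα`. -/
  parseval : ∀ r : ℝ → ℝ, (∀ u, r (-u) = r u) → Continuous r → Integrable r →
    Integrable r ρ₂ → Integrable (BGMM2023.cosTransform r) ν →
      r 0 + ∫ u, r u ∂ρ₂ =
        BGMM2023.cosTransform r 0 + (2 * ∫ α in (0 : ℝ)..1, α * BGMM2023.cosTransform r α)
          + ∫ α, BGMM2023.cosTransform r α ∂ν

/-- TAMENESS of a witness pair (v1.2): every admissible test function and its transform are integrable
against `ρ₂`, `ν` (and `r̂` is continuous).  This is a property OF THE WITNESS, asserted by each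
existence statement below — it closes the junk loophole of the bare structure (`ν = ∞·𝟙_{|α|>1}` makes
`parseval` vacuous, since then only band-limited `r` are `ν`-integrable); for lattice `ρ₂` with bounded
weights and `2m`-periodic locally finite `ν` it follows from the decay fields of `IsFloorAdmissible`. -/
def IsTameWitness (ρ₂ ν : Measure ℝ) : Prop :=
  ∀ (r : ℝ → ℝ) (lam : ℝ), IsFloorAdmissible r lam →
    Integrable r ρ₂ ∧ Integrable (BGMM2023.cosTransform r) ν ∧ Continuous (BGMM2023.cosTransform r)

/-- `r̂` is even (cosine transform). -/
theorem cosTransform_neg (r : ℝ → ℝ) (α : ℝ) :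
    BGMM2023.cosTransform r (-α) = BGMM2023.cosTransform r α := by
  unfold BGMM2023.cosTransform
  congr 1
  ext u
  simp only [mul_neg, neg_mul, Real.cos_neg]

/-- WEAK DUALITY (PROVED): a dual witness at height `c` on `(1,B)` forbids every one-sided certificate
at height `c`, any window `< ½` — three sign checks: `∫ r dρ₂ ≤ 0` (`r ≤ 0` on `|u| ≥ ½ > λ`),
`∫ r̂ dν ≥ 2c∫₁ᴮ r̂` (`r̂ ≥ 0` beyond 1, `ν ≥ c` there), `r(0) = 1`.  (`Continuous r̂` is automatic for
`r ∈ L¹`; kept as a hypothesis to stay elementary.) -/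
theorem weakDuality_floor {ρ₂ ν : Measure ℝ} {c B lam : ℝ} (hw : IsDualWitness ρ₂ ν c B)
    (hc : 0 ≤ c) (hB : 1 ≤ B) (hlam : lam < 1 / 2) {r : ℝ → ℝ} (hr : IsFloorAdmissible r lam)
    (hrρ : Integrable r ρ₂) (hrν : Integrable (BGMM2023.cosTransform r) ν)
    (hcont : Continuous (BGMM2023.cosTransform r)) : cValueHeight r c B ≤ 0 := by
  set R := BGMM2023.cosTransform r with hR
  -- (1) the pair side is ≤ 0
  have h1 : ∫ u, r u ∂ρ₂ ≤ 0 := by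
    apply integral_nonpos_of_ae
    have hae : ∀ᵐ u ∂ρ₂, u ∉ Set.Ioo (-(1 / 2 : ℝ)) (1 / 2) := by
      rw [ae_iff]; simpa only [not_not, Set.setOf_mem_eq] using hw.core
    filter_upwards [hae] with u hu
    simp only [Set.mem_Ioo, not_and_or, not_lt] at hu
    have hu' : (1 / 2 : ℝ) ≤ |u| := by
      rcases hu with h | h
      · rw [abs_of_nonpos (by linarith)]; linarith
      · rw [abs_of_nonneg (by linarith)]; linarith
    exact hr.nonpos u (lt_of_lt_of_le hlam hu')
  -- (2) the form-factor side beyond the diagonal is ≥ the floor credit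
  have hnn : 0 ≤ᵐ[ν] R := by
    have hae : ∀ᵐ α ∂ν, α ∉ Set.Icc (-1 : ℝ) 1 := by
      rw [ae_iff]; simpa only [not_not, Set.setOf_mem_eq] using hw.offDiag
    filter_upwards [hae] with α hα
    simp only [Set.mem_Icc, not_and_or, not_le] at hα
    have hα' : (1 : ℝ) ≤ |α| := by
      rcases hα with h | h
      · rw [abs_of_nonpos (by linarith)]; linarith
      · rw [abs_of_nonneg (by linarith)]; linarith
    exact hr.transform_nonneg_tail α hα'
  have hS : ∫ α, R α ∂((ENNReal.ofReal c) • volume.restrict (Set.Ioo (1 : ℝ) B ∪ Set.Ioo (-B) (-1)))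
      ≤ ∫ α, R α ∂ν := integral_mono_measure hw.floor hnn hrν
  rw [integral_smul_measure, ENNReal.toReal_ofReal hc, smul_eq_mul] at hS
  have hIO : ∀ a b : ℝ, IntegrableOn R (Set.Ioo a b) volume := fun a b =>
    (hcont.integrableOn_Icc).mono_set Set.Ioo_subset_Icc_self
  have hunion : ∫ α in Set.Ioo (1 : ℝ) B ∪ Set.Ioo (-B) (-1), R α =
      (∫ α in Set.Ioo (1 : ℝ) B, R α) + ∫ α in Set.Ioo (-B) (-1), R α := by
    refine setIntegral_union ?_ measurableSet_Ioo (hIO _ _) (hIO _ _)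
    rw [Set.disjoint_iff]
    rintro x ⟨⟨h1x, -⟩, ⟨-, hx2⟩⟩
    linarith
  have hpos : ∫ α in Set.Ioo (1 : ℝ) B, R α = ∫ α in (1 : ℝ)..B, R α := by
    rw [intervalIntegral.integral_of_le hB, integral_Ioc_eq_integral_Ioo]
  have hnegside : ∫ α in Set.Ioo (-B) (-1), R α = ∫ α in (1 : ℝ)..B, R α := by
    have hB' : -B ≤ -1 := by linarith
    rw [← integral_Ioc_eq_integral_Ioo, ← intervalIntegral.integral_of_le hB']
    have : (fun α => R α) = fun α => R (-α) := by ext α; exact (cosTransform_neg r α).symm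
    calc ∫ α in (-B)..(-1), R α = ∫ α in (-B)..(-1), R (-α) := by
            exact intervalIntegral.integral_congr fun α _ => (cosTransform_neg r α).symm
      _ = ∫ α in (1 : ℝ)..B, R α := by
            rw [intervalIntegral.integral_comp_neg]; simp
  rw [hunion, hpos, hnegside] at hS
  -- (3) Montgomery pairing + r(0) = 1
  have h3 := hw.parseval r hr.even hr.continuous hr.integrable hrρ hrν
  rw [hr.map_zero] at h3
  unfold cValueHeight BGMM2023.cValue
  linarith

/-- Statement form of weak duality (for the card's register). -/
def WeakDualityFloor : Prop :=
  ∀ (ρ₂ ν : Measure ℝ) (c B lam : ℝ), IsDualWitness ρ₂ ν c B → 0 ≤ c → 1 ≤ B → lam < 1 / 2 →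
    ∀ r : ℝ → ℝ, IsFloorAdmissible r lam → Integrable r ρ₂ →
      Integrable (BGMM2023.cosTransform r) ν → Continuous (BGMM2023.cosTransform r) →
        cValueHeight r c B ≤ 0

/-- WEAK DUALITY packaged: PROVED. -/
theorem weakDualityFloor_holds : WeakDualityFloor :=
  fun _ _ _ _ _ hw hc hB hlam _ hr hrρ hrν hcont => weakDuality_floor hw hc hB hlam hr hrρ hrν hcont

/-! ### The AH¼ witness in closed form (`m = 2`: `ρ₂ = Σ_{k ≥ 2} c_k δ_{±k/4}`, `F` 4-periodic,
`F = |α| + δ₀` on `[−1,1]`, `F = t + b δ_{±2}` on `1 < |α| < 3`) -/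

/-- Floor level of the AH¼ witness: `t = (π² − 4π + 8)/(2π(π − 2)) = 0.7393494…` (forced by `c_1 = 0`
and unit mass per period). -/
noncomputable def quarterLevel : ℝ := (π ^ 2 - 4 * π + 8) / (2 * π * (π - 2))

/-- Bragg atom of the AH¼ witness at `α = ±2 (mod 4)`: `b = 2 − 2t = 0.5213…`. -/
noncomputable def quarterAtom : ℝ := 2 - 2 * quarterLevel

/-- Sinc-square Fourier coefficient of the Montgomery core `|α| + δ₀` on `[−1,1]` at frequency `k/4`:
`A_k = 1 + 2 sin x/x + 2(cos x − 1)/x²`, `x = πk/2` (`k ≥ 1`). -/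
noncomputable def coreCoeff (k : ℕ) : ℝ :=
  1 + 2 * Real.sin (π * k / 2) / (π * k / 2) + 2 * (Real.cos (π * k / 2) - 1) / (π * k / 2) ^ 2

/-- Pair weights of the AH¼ witness: `4 c_k = A_k + t·D_k + b(−1)^k` with `D_k = (4/πk) sin(πk/2)·(−1) …`;
written out by residue of `k (mod 4)`:
`4c_k = 1 + b` (`k ≡ 0`), `1 + b − 16/(π²k²)` (`k ≡ 2`), `(1 − b) + (4/πk)(1 − t) − 8/(π²k²)` (`k ≡ 1`),
`(1 − b) − (4/πk)(1 − t) − 8/(π²k²)` (`k ≡ 3`). -/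
noncomputable def quarterCoeff (k : ℕ) : ℝ :=
  if k % 4 = 0 then (1 + quarterAtom) / 4
  else if k % 4 = 2 then (1 + quarterAtom - 16 / (π ^ 2 * (k : ℝ) ^ 2)) / 4
  else if k % 4 = 1 then ((1 - quarterAtom) + 4 / (π * k) * (1 - quarterLevel) - 8 / (π ^ 2 * (k : ℝ) ^ 2)) / 4
  else ((1 - quarterAtom) - 4 / (π * k) * (1 - quarterLevel) - 8 / (π ^ 2 * (k : ℝ) ^ 2)) / 4

/-- HARD CORE of the AH¼ witness: no pairs at distance `¼` (PROVED: an identity in `π`). -/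
theorem quarterCoeff_one : quarterCoeff 1 = 0 := by
  have hπ : π ≠ 0 := Real.pi_ne_zero
  have hπ2 : π - 2 ≠ 0 := by have := Real.pi_gt_three; linarith
  unfold quarterCoeff quarterAtom quarterLevel
  simp only [Nat.one_mod, Nat.cast_one]
  norm_num
  field_simp
  ring

/-- POSITIVITY of the AH¼ witness (statement; PROVED below as `quarterWitnessNonneg`; the minimum over `k ≥ 2` is `c_3 = 0.0695…`, and
for `k ≡ 1,3 (4)` `4c_k ≥ (1 − b) − (4/3π)(1 − t) − 8/(9π²) > 0`). -/
def QuarterWitnessNonneg : Prop := ∀ k : ℕ, 2 ≤ k → 0 ≤ quarterCoeff k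

/-- `t ≤ 1` (⇔ `8 ≤ π²`). -/
theorem quarterLevel_le_one : quarterLevel ≤ 1 := by
  unfold quarterLevel
  have hπ3 := Real.pi_gt_three
  have hpos : 0 < 2 * π * (π - 2) := by nlinarith
  rw [div_le_one hpos]
  nlinarith

/-- `7/10 ≤ t` (⇔ `0.4π² + 1.2π ≤ 8`, true for `π < 3.15`). -/
theorem seven_tenths_le_quarterLevel : (7 : ℝ) / 10 ≤ quarterLevel := by
  unfold quarterLevel
  have hπ3 := Real.pi_gt_three
  have hπ4 := Real.pi_lt_d2
  have hpos : 0 < 2 * π * (π - 2) := by nlinarith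
  rw [le_div_iff₀ hpos]
  nlinarith

/-- POSITIVITY of the AH¼ witness — PROVED (all pair weights `c_k`, `k ≥ 2`, are nonnegative; uses only
`3 < π < 3.15` through `7/10 ≤ t ≤ 1`). Together with `quarterCoeff_one` this makes the AH¼ data a
positive, hard-core-½ pair pseudo-measure; the remaining typed link is the Poisson identity
`QuarterWitnessExists`. -/
theorem quarterWitnessNonneg : QuarterWitnessNonneg := by
  intro k hk
  have ht1 := quarterLevel_le_one
  have ht0 := seven_tenths_le_quarterLevel
  have hπ3 := Real.pi_gt_three
  have hπ0 : 0 < π := Real.pi_pos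
  have hk' : (2 : ℝ) ≤ k := by exact_mod_cast hk
  have hkpos : (0 : ℝ) < k := by linarith
  have hπk : 0 < π * k := mul_pos hπ0 hkpos
  have hπk2 : 0 < π ^ 2 * (k : ℝ) ^ 2 := by positivity
  -- the two `k`-dependent corrections are small for `k ≥ 2`
  have hB : 8 / (π ^ 2 * (k : ℝ) ^ 2) ≤ 8 / 36 := by
    rw [div_le_div_iff₀ hπk2 (by norm_num)]
    nlinarith [mul_le_mul hπ3.le hk' (by norm_num) hπ0.le]
  have hC : 16 / (π ^ 2 * (k : ℝ) ^ 2) ≤ 16 / 36 := by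
    rw [div_le_div_iff₀ hπk2 (by norm_num)]
    nlinarith [mul_le_mul hπ3.le hk' (by norm_num) hπ0.le]
  unfold quarterCoeff quarterAtom
  split_ifs with h0 h2 h1
  · exact div_nonneg (by linarith) (by norm_num)
  · exact div_nonneg (by linarith) (by norm_num)
  · have hA : 0 ≤ 4 / (π * k) * (1 - quarterLevel) :=
      mul_nonneg (div_nonneg (by norm_num) hπk.le) (by linarith)
    exact div_nonneg (by linarith) (by norm_num)
  · -- `k % 4 = 3`, hence `k ≥ 3`
    have hk3 : (3 : ℝ) ≤ k := by
      have : 3 ≤ k := by omega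
      exact_mod_cast this
    have hπk9 : 9 ≤ π * k := by nlinarith
    have hdiv : 4 / (π * k) ≤ 4 / 9 := by
      rw [div_le_div_iff₀ hπk (by norm_num)]
      nlinarith
    have hA : 4 / (π * k) * (1 - quarterLevel) ≤ 4 / 9 * (3 / 10) :=
      mul_le_mul hdiv (by linarith) (by linarith) (by norm_num)
    have hB' : 8 / (π ^ 2 * (k : ℝ) ^ 2) ≤ 8 / 81 := by
      rw [div_le_div_iff₀ hπk2 (by norm_num)]
      nlinarith [mul_le_mul hπ3.le hk3 (by norm_num) hπ0.le]
    exact div_nonneg (by linarith) (by norm_num)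

/-- The AH¼ data as a dual witness: `ρ₂ = Σ_{k≥2} c_k (δ_{k/4} + δ_{−k/4})`, `ν = ` the 4-periodic
extension of `t·𝟙 + b δ_{±2} + (|α − 4j| + δ_{4j})` restricted to `|α| > 1`.  CONSTRUCTION statement
(typed; proof = Poisson summation on `¼ℤ` for the test class + `quarterCoeff_one` + `quarterWitnessNonneg`
+ tameness from the decay fields).  v1.2: tameness is part of the claim. -/
def QuarterWitnessExists : Prop :=
  ∃ ρ₂ ν : Measure ℝ, IsDualWitness ρ₂ ν quarterLevel 3 ∧ IsTameWitness ρ₂ ν ∧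
    ρ₂ = (Measure.sum fun k : ℕ =>
      (ENNReal.ofReal (quarterCoeff (k + 2))) •
        (Measure.dirac ((k + 2 : ℝ) / 4) + Measure.dirac (-((k + 2 : ℝ) / 4))))

/-- LOWER EDGE OF THE HEIGHT WALL (consequence of the two statements above + weak duality; COMPUTED
closed form `quarterLevel = 0.739349…`): no one-sided certificate exists for any height `c ≤ t`, any
`B ≤ 3`, any window `< ½` — in particular K-L21-1's wall (`0.773` at `B = 2`, `λ = 0.499`) cannot drop
below `0.7393` in ANY minorant degree.  LP witnesses (`m = 24`) raise the edge to `0.7674` at `B = 2`. -/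
def HeightWallLowerEdge : Prop :=
  ∀ c B lam : ℝ, c ≤ quarterLevel → B ≤ 3 → lam < 1 / 2 → ¬ HeightCertificate c B lam

/-- MONOTONICITY of dual witnesses in the floor data (PROVED): lowering the height `c' ↦ c ≤ c'`
and shrinking the range `B' ↦ B ≤ B'` keeps a witness a witness. -/
theorem IsDualWitness.mono {ρ₂ ν : Measure ℝ} {c c' B B' : ℝ} (hw : IsDualWitness ρ₂ ν c' B')
    (hcc' : c ≤ c') (hBB' : B ≤ B') : IsDualWitness ρ₂ ν c B where
  core := hw.core
  offDiag := hw.offDiag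
  floor := by
    refine le_trans ?_ hw.floor
    have hS : Set.Ioo (1 : ℝ) B ∪ Set.Ioo (-B) (-1) ⊆ Set.Ioo (1 : ℝ) B' ∪ Set.Ioo (-B') (-1) :=
      Set.union_subset_union (Set.Ioo_subset_Ioo le_rfl hBB')
        (Set.Ioo_subset_Ioo (neg_le_neg hBB') le_rfl)
    have h1 : volume.restrict (Set.Ioo (1 : ℝ) B ∪ Set.Ioo (-B) (-1)) ≤
        volume.restrict (Set.Ioo (1 : ℝ) B' ∪ Set.Ioo (-B') (-1)) :=
      Measure.restrict_mono hS le_rfl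
    have h2 : ENNReal.ofReal c ≤ ENNReal.ofReal c' := ENNReal.ofReal_le_ofReal hcc'
    rw [Measure.le_iff]
    intro s hs
    simp only [Measure.smul_apply, smul_eq_mul]
    exact mul_le_mul' h2 ((Measure.le_iff.1 h1) s hs)
  parseval := hw.parseval

/-- COMPOSITION (PROVED from `QuarterWitnessExists` ALONE, v1.2): monotonicity (`IsDualWitness.mono`),
the negative-height case (for `c < 0` the floor credit `2c∫₁ᴮ r̂ ≤ 0` because `r̂ ≥ 0` beyond `1`, so the
level-`0` witness already kills the certificate) and the integrability side conditions (tameness, now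
part of the existence statement) are all discharged. -/
theorem heightWallLowerEdge_of (hQ : QuarterWitnessExists) : HeightWallLowerEdge := by
  intro c B lam hc hB hlam hcert
  obtain ⟨hB1, r, hr, hpos⟩ := hcert
  obtain ⟨ρ₂, ν, hwit, htame, -⟩ := hQ
  obtain ⟨hi1, hi2, hi3⟩ := htame r lam hr
  have ht0 : (0 : ℝ) ≤ quarterLevel := le_trans (by norm_num) seven_tenths_le_quarterLevel
  by_cases hc0 : 0 ≤ c
  · have hwit' : IsDualWitness ρ₂ ν c B := hwit.mono hc hB
    have := weakDuality_floor hwit' hc0 hB1 hlam hr hi1 hi2 hi3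
    linarith
  · have hw0 : IsDualWitness ρ₂ ν 0 B := hwit.mono ht0 hB
    have h0 := weakDuality_floor hw0 le_rfl hB1 hlam hr hi1 hi2 hi3
    have hI : 0 ≤ ∫ α in (1 : ℝ)..B, BGMM2023.cosTransform r α := by
      apply intervalIntegral.integral_nonneg hB1
      intro x hx
      exact hr.transform_nonneg_tail x (by rw [abs_of_nonneg (by linarith [hx.1])]; exact hx.1)
    have hcneg : c < 0 := lt_of_not_ge hc0
    have hle : cValueHeight r c B ≤ cValueHeight r 0 B := by
      unfold cValueHeight
      nlinarith
    linarith

/-! ### The Laplace and S-variance currencies (K-L21-2) at witness grade -/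

/-- Laplace mass beyond the diagonal of a dual witness' form factor: `Λ_ν(a) = ½∫ e^{−2a|α|} dν`
(the `½` because `ν` carries both signs of `α`). -/
noncomputable def laplaceMass (ν : Measure ℝ) (a : ℝ) : ℝ := (∫ α, Real.exp (-2 * a * |α|) ∂ν) / 2

/-- `Λ_GUE(a) = e^{−2a}/(2a)` (lineage K-L21-2). -/
noncomputable def laplaceTailGUE (a : ℝ) : ℝ := Real.exp (-2 * a) / (2 * a)
/-- `Λ_AH(a) = Λ_GUE(a) − ((sinh a/a)² − 1)/(e^{4a} − 1)` (lineage K-L21-2). -/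
noncomputable def laplaceTailAH (a : ℝ) : ℝ :=
  laplaceTailGUE a - ((Real.sinh a / a) ^ 2 - 1) / (Real.exp (4 * a) - 1)

/-- COMPUTED CLAIM (LP over `(1/16)ℤ`- and `(1/24)ℤ`-supported pair measures, `c_k ≥ 0` verified on
`≥ 60` `k`-periods + residue-class asymptotics; files `lap1_m8_a*.json`, `lap1_m12_a*_N32.json`):
hard-core-½ pair-level witnesses with Montgomery core carry Laplace mass
`Λ_w(0.3) = 0.90269`, `Λ_w(0.5) = 0.35602`, `Λ_w(0.7) = 0.16677`, `Λ_w(1) = 0.06254`, `Λ_w(1.25) = 0.03025`,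
`Λ_w(1.5) = 0.015535`, `Λ_w(2) = 0.004656`, `Λ_w(2.5) = 0.001546`, `Λ_w(3) = 0.000543` — above
`Λ_AH(a)` at every listed `a` (NO TIE AT AH) and above `Λ_GUE(a)` for `a ∈ {2, 2.5, 3}`. -/
def LaplaceNoTieAtAH : Prop :=
  ∀ a ∈ ({0.3, 0.5, 0.7, 1, 1.25, 1.5, 2, 2.5, 3} : Set ℝ),
    ∃ ρ₂ ν : Measure ℝ, IsDualWitness ρ₂ ν 0 1 ∧ IsTameWitness ρ₂ ν ∧ laplaceTailAH a < laplaceMass ν a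

/-- COMPUTED CLAIM, final at witness grade: for `a ≥ 2` (listed values) a hard-core-½ pair-level witness
EXCEEDS the pair-correlation-conjecture Laplace mass, so NO Laplace-floor certificate at or below the
PC value exists in any minorant class — the K-L21-2 door is CLOSED there (gen 0 had this solver-grade
for `a ≥ 1.5`; at `a ∈ {1.5, 1.75}` the witnesses stay below `Λ_GUE`: undecided at witness grade). -/
def LaplaceDoorClosedBeyondTwo : Prop :=
  ∀ a ∈ ({2, 2.5, 3} : Set ℝ),
    ∃ ρ₂ ν : Measure ℝ, IsDualWitness ρ₂ ν 0 1 ∧ IsTameWitness ρ₂ ν ∧ laplaceTailGUE a < laplaceMass ν a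

/-! ### The REALISABILITY DOOR — the statement just outside the pair-positivity class -/

/-- KLS-REALISABILITY of unit-intensity, hard-core-`D` pair data `ρ₂` on `ℝ` (Kuna–Lebowitz–Speer 2011,
Theorem 3.2: under a hard core, `(1, ρ₂)` is the correlation pair of a point process iff every
"quadratic polynomial" `f₀ + Σᵢ f₁(xᵢ) + Σ_{i≠j} f₂(xᵢ,xⱼ)` that is `≥ 0` on hard-core configurations has
`≥ 0` expectation).  Stated on finite configurations (compactly supported `f₁, f₂`). -/
def KLSRealisable (D : ℝ) (ρ₂ : Measure ℝ) : Prop :=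
  ∀ (f₀ : ℝ) (f₁ : ℝ → ℝ) (f₂ : ℝ → ℝ → ℝ),
    Continuous f₁ → HasCompactSupport f₁ →
    Continuous (fun p : ℝ × ℝ => f₂ p.1 p.2) → HasCompactSupport (fun p : ℝ × ℝ => f₂ p.1 p.2) →
    (∀ s : Finset ℝ, (∀ x ∈ s, ∀ y ∈ s, x ≠ y → D ≤ |x - y|) →
        0 ≤ f₀ + ∑ x ∈ s, f₁ x + ∑ x ∈ s, ∑ y ∈ s.erase x, f₂ x y) →
      0 ≤ f₀ + (∫ x, f₁ x) + ∫ x, ∫ u, f₂ x (x + u) ∂ρ₂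

/-- The REALISABLE dual value of the height door: a dual witness at height `c` on `(1,B)` whose `ρ₂` is the
pair correlation of an honest hard-core-½ point process (v1.2: and the pair is tame — without this the
junk `ν = ∞·𝟙_{|α|>1}` paired with AH's realisable `ρ₂` would satisfy the definition for every `c, B`
and make `RealisabilityDoor` vacuous). -/
def RealisableWitness (c B : ℝ) : Prop :=
  ∃ ρ₂ ν : Measure ℝ, IsDualWitness ρ₂ ν c B ∧ IsTameWitness ρ₂ ν ∧ KLSRealisable (1 / 2) ρ₂

/-- THE REALISABILITY DOOR (typed TARGET; informal proof = local weak limits of the unfolded zero process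
along `T → ∞` (tightness from `N(T)`), Montgomery's theorem for the limit's form factor on `[−1,1]`,
the floor passing to the limit as a measure inequality, and the contrapositive: if NO realisable witness
exists at height `c` on `(1,B)`, then under RH the floor input forces a positive proportion of gaps
`≤ λ` for some `λ < ½` (diagonal argument over `λ ↑ ½`), whence BGMM's `GapDensityPos`, the tree's
`subnormalGapsHypothesis_of_gapDensityPos`, and the CI door).  Strictly WEAKER hypothesis than any LP
certificate (`HeightCertificate c B lam → ¬ RealisableWitness c B` by weak duality), and EXACT: if a
realisable witness exists, no argument using only RH + Montgomery + the floor + "the zeros are a point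
process" can open the door. -/
def RealisabilityDoor (c B : ℝ) : Prop :=
  RiemannHypothesis → ¬ RealisableWitness c B →
    (∀ ε : ℝ, 0 < ε → ∀ᶠ T : ℝ in Filter.atTop, ∀ α : ℝ, 1 ≤ |α| → |α| ≤ B →
        c - ε ≤ montgomeryFormFactor α T) →
      ∃ lam : ℝ, lam < 1 / 2 ∧ BGMM2023.GapDensityPos lam

/-- COMPUTED (finite-window LP hierarchy = KLS cone truncated to `n` consecutive sites of `(1/2m)ℤ`,
`l21g2_realize.py`; Yamada's variance condition `l21g2_yamada.py`): the AH¼ pair data passes every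
window test for `n ≤ 18` quarter-sites and the `m = 3` floor witness (`t = 0.7551`) for `n ≤ 24`
sixth-sites; no Farkas cut (= KLS polynomial) was found.  CONJECTURE shape recorded for the critic: -/
def QuarterWitnessRealisable : Prop := RealisableWitness quarterLevel 3

end Summit.Parity.GeneralizedHardyLittlewood.Theorems.PrimeLevelFamEdgeIdeaDeltas.FloorDual
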